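import Literature.MathematicalPhysics.QuantumFieldTheory.Balaban1983to89.B9

/-!
# `Balaban1983to89.B9GaugeReduction335Whole` — [B9] Cor. 3.6's GAUGE REDUCTION (p. 408) AS THE WHOLE PRINTED LEAF
# `B9.GaugeReduction335`: a glue module over two hypothesis schemas of printed shape (the gauge fixing of (3.35) on □,
# and the gauge invariance of all the readings of Theorems 3.1–3.3, (3.28)–(3.34) + p. 398), plus the located vacuity of
# the leaf when no member satisfies «Ω′₀ ⊂ □»

T. Bałaban, *Propagators for lattice gauge theories in a background field*, Commun. Math. Phys. **99** (1985) 389–434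
[`Balaban1985BackgroundPropagators`, "B9"] (journal page = PDF page + 388).

statement-level skeleton of published theorems with citation tags; proofs where landed; nothing here is a claim about the
Yang–Mills mass gap

THE PRINTED LOCI (verbatim).  p. 408 [PDF 20], ll. 1–6 (proof of Corollary 3.6): *"… and such that Ω′₀ ⊂ □, where □ is one
of the cubes appearing in the formulation of (3.35). For simplicity we have assumed that j = k, otherwise we can rescale
from η-lattice to L^{−j}-lattice. Applying the gauge transformation u we get U′ = U^u = e^{iηA} with A satisfying the
inequalities in (3.35) for j = k. This implies that U′ satisfies (3.37) for the sequence {Ω′_j}, with U = 1 and α₁ = O(1)Mα₀.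
Assuming O(1)Mα₀ ≦ a₁ we can apply the above Corollary and we get [Corollary 3.6] … we have to recall only that all the
results of these theorems are gauge invariant."*; p. 398 [PDF 10] (after (3.47)): *"All these inequalities are invariant
with respect to gauge transformations of U."*; pp. 395–396 (3.28)–(3.34): U → U^u, U′ → R(u)U′ (3.28), J^u = R(u)J,
Δ^η(U^u) = R(u)Δ^η(U)R(u^{−1}) (3.30)–(3.31), (Q′_j(U^u)R(u)λ)(y) = R(u(y))(Q′_j(U)λ)(y) (3.32), G′(U^u) = R(u)G′(U)R(u^{−1}),
R(U^u) = R(u)R(U)R(u^{−1}) (3.33), Δ_a(U^u) = R(u)Δ_a(U)R(u^{−1}), G(U^u) = R(u)G(U)R(u^{−1}) (3.34); p. 390: |X| of an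
N × N matrix is the (normalised) Hilbert–Schmidt norm — unitarily invariant.

THE POINT.  The cell's typed skeleton `…Balaban1983to89.B9` carries the gauge reduction as ONE by-reference leaf over the
abstract carriers (`B9.GaugeReduction335 d c35 geo bg InCube Gp GA Cinv`, GAPS G-B9-14 «certified-routine: (3.34) + unitary
invariance of the HS norm»): for a member with `InCube i`, a configuration U in the class (3.35) admits U′ in the complex
class (3.37) around U = 1 with α₁ = O(1)Mα₀ such that the inequality block `B9.Thms31to33IneqAt` TRANSFERS from U′·1 to U.
The knits `B9.cor36_of_cor35`, `B9.sectsAC_architecture`, `B9LeafKnit.b9Leaf_of_leaves`, `DagBinding.B9LeafX` consume it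
as the hypothesis `hg`; no theorem concluded it (N06 ASSIGNMENT row 14, «free»).  THIS FILE is that glue:

* §1 the MECHANISM of p. 398 over the abstract carrier, reading by reading: `ArgRelabel g` — the relabeling λ ↦ R(u)λ of
  arguments and ζ ↦ ζ of cut-offs, support-preserving and NORM-PRESERVING ((3.39)–(3.41): |R(u)λ| = |λ|, ‖R(u)λ‖ = ‖λ‖,
  |R(u)λ|_{(γ)} = |λ|_{(γ)}, the Hölder norms with parallel transport, p. 397); `KernelReadingsInvariant K U V r` — the six
  readings `e, h1, e4, h2, l2, glob` ((3.42)–(3.47)) of an operator family K at U EQUAL its readings at V = U^u on the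
  relabelled arguments (X(U^u) = R(u)X(U)R(u^{−1}) for X = G′, G, ∇_U, ∇*_U, Δ_U by (3.31)–(3.34), and |R(u(x))Y| = |Y|:
  the lattice-level mechanism is `B9Eq333Cov.kernel_bound_iff` ∕ `norm_gaugeAct` ∕ `norm_kerConj`, the laws themselves are
  `B9Eq328GaugeAction` (derivative letters), `B9Eq330HessianCovariance` ((3.30)), `B9Eq332AvgCovariance` ∕
  `B9Eq332FieldAvgCovariance` ((3.32)), `B9Eq333Cov.g_intertwine` ∕ `c_intertwine` ∕ `G_intertwine` ((3.33)–(3.34)) on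
  the tree's concrete carriers — CITED, not imported: this module stays over the abstract carrier of `…B9`).
  `ineq342_346_347_of_invariant`, `ineq343_345_of_invariant`, `kerBound_of_invariant`, `thms31to33IneqAt_of_invariant`:
  the blocks of Theorems 3.1–3.3 transfer from V to U along a relabel — pure rewriting, NO sign facts of the carrier.
  `ArgRelabel.refl`, `KernelReadingsInvariant.refl`: the schemas are inhabited at u = 1 (honesty: not vacuous, not junk).
* §2 the two printed inputs as family schemas: `GaugeFix335 c35 geo bg InCube Rel` — p. 408 ll. 1–6: InCube i, U in the
  class (3.35) with α₀ ⇒ ∃ U′ in (3.37) around 1 with α₁ = c35·M·α₀ and U GAUGE-RELATED to U′·1 (`Rel i U (mul U′ one)`,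
  `Rel` = «U = V^u on □ for a gauge transformation u» kept ABSTRACT — the existence of u is [B7]-type gauge fixing, GAPS
  G-B9-14 prose, not in the tree); `ReadingsGaugeInvariant geo bg Gp GA Cinv Rel` — every related pair carries a relabel
  along which the readings of G′, G and the kernel of (Q′G′²Q′*)^{−1} are invariant; `readingsGaugeInvariant_eq` (at
  `Rel := Eq` it holds — inhabited).
* §3 ★ `gaugeReduction335_of_gaugeFix` — **THE WHOLE PRINTED LEAF** `B9.GaugeReduction335 d c35 geo bg InCube Gp GA Cinv`
  from `GaugeFix335` and `ReadingsGaugeInvariant` (for ANY `Rel`).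
* §4 ★ `gaugeReduction335_of_not_inCube` — THE LOCATED VACUITY: if NO member satisfies «Ω′₀ ⊂ □» the leaf holds for every
  operator family and every constant (it is `∀ i, InCube i → …`).  This IS the situation at pub-ymgap's pin of record
  (`B9PinGeometryKLevelV1.not_inCubeY`: on def-Y's torus families `Ω₀ = T_η` never fits in a (3.35)-class cube — the same
  located frame limitation behind `B9PinGeometryKLevelV1.cor36Printed_vacuous`); there the binder `hg` of the N06 knit
  (`…N06AtRecord11CB10YZW.b9_main_of_up_view₁₁B10YZW_of_obligations`) is supplied by this lemma at
  `h := B9PinGeometryKLevelV1.not_inCubeY` — recorded so that no one reads content into it.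

HONEST SCOPE.  Nothing of print is asserted: the gauge fixing on □ and the covariance∕invariance laws are HYPOTHESES of
printed shape; the Hölder norms (3.40) are U-independent fields of the abstract carrier (r1's typing), so the schema's
`holder`-clause reads print's parallel-transport invariance, located (G-B9-14 prose); (3.35)'s «j = k, otherwise rescale»
is inside `GaugeFix335`.  Value: kernel-checked bookkeeping of the two printed words «This implies» (p. 408) and «are gauge
invariant» (p. 398 ∕ p. 408) — the leaf inhabited over named inputs, and its vacuity at the pin of record located — NOT a
node discharge, NOT summit progress; one finite lattice programme; nothing continuum, nothing about the mass gap.  Cell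
`pub-ymgap` (HUMAN RULING D-0062), Track A node N06 [B9], N06-ASSIGNMENT v1 row 14 (bundle F4), seat `pub-ymgap-dag-n06-i`,
2026-08-26.
-/

namespace Literature.MathematicalPhysics.QuantumFieldTheory.Balaban1983to89.B9GaugeReduction335Whole

open Literature.MathematicalPhysics.QuantumFieldTheory.Balaban1983to89

/-! ## §1 The mechanism of p. 398 over the abstract carrier: relabeling of arguments, invariance of readings -/

section OneMember

variable {g : B9.Geometry} {B : B9.Backgrounds}

/-- **THE RELABELING OF ARGUMENTS AND CUT-OFFS UNDER A GAUGE TRANSFORMATION** u of the member's lattice, over the abstract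
carrier of `…B9`: `τ` = λ ↦ R(u)λ on arguments ((3.28), (3.32): (R(u)λ)(x) = R(u(x))λ(x)), `σ` = the action on cut-offs
ζ, h (scalar functions: the identity in print, kept as a map for symmetry of the schema).  Both preserve the support
predicates (supp R(u)λ = supp λ ⊂ Δ(y′) ∕ Δ̃(y′)) and ALL the norms of (3.39)–(3.41) p. 397 — |λ|, ‖λ‖, |λ|_{(γ)}, the Hölder
norms ‖λ‖_ε (with U-parallel transport in print; U-independent fields in r1's carrier — located), ‖ζ‖^ξ_β + |ζ|, |h| — since
R(u(x)) is unitary on the fibre (p. 390: |X| is the normalised Hilbert–Schmidt norm).  A PARAMETER RECORD with laws;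
`ArgRelabel.refl` inhabits it. [cite: Balaban1985BackgroundPropagators, (3.28) p.395 + (3.39)–(3.41) p.397 + p.398 («invariant with respect to gauge transformations»)] -/
structure ArgRelabel (g : B9.Geometry) where
  τ : g.Loc → g.Loc
  σ : g.Cut → g.Cut
  suppIn : ∀ (lam : g.Loc) (y : g.Site), g.suppIn lam y → g.suppIn (τ lam) y
  suppInT : ∀ (lam : g.Loc) (y : g.Site), g.suppInT lam y → g.suppInT (τ lam) y
  cutIn : ∀ (ζ : g.Cut) (y : g.Site), g.cutIn ζ y → g.cutIn (σ ζ) y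
  cutInT : ∀ (ζ : g.Cut) (y : g.Site), g.cutInT ζ y → g.cutInT (σ ζ) y
  supNorm : ∀ lam : g.Loc, g.supNorm (τ lam) = g.supNorm lam
  l2Norm : ∀ lam : g.Loc, g.l2Norm (τ lam) = g.l2Norm lam
  wNorm : ∀ (γ : ℝ) (lam : g.Loc), g.wNorm γ (τ lam) = g.wNorm γ lam
  holder : ∀ (ε : ℝ) (lam : g.Loc), g.holder ε (τ lam) = g.holder ε lam
  cutH : ∀ (β : ℝ) (ζ : g.Cut), g.cutH β (σ ζ) = g.cutH β ζ
  cutSup : ∀ ζ : g.Cut, g.cutSup (σ ζ) = g.cutSup ζ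

/-- The trivial relabeling (u ≡ 1): identity on arguments and cut-offs (the u = 1 instance of (3.28)).
[cite: Balaban1985BackgroundPropagators, (3.28) p.395 (bookkeeping: the identity gauge transformation)] -/
def ArgRelabel.refl (g : B9.Geometry) : ArgRelabel g where
  τ := id
  σ := id
  suppIn _ _ h := h
  suppInT _ _ h := h
  cutIn _ _ h := h
  cutInT _ _ h := h
  supNorm _ := rfl
  l2Norm _ := rfl
  wNorm _ _ := rfl
  holder _ _ := rfl
  cutH _ _ := rfl
  cutSup _ := rfl

/-- **THE READINGS OF AN OPERATOR FAMILY ARE GAUGE INVARIANT** (p. 398: *"All these inequalities are invariant with respect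
to gauge transformations of U"*; p. 408: *"all the results of these theorems are gauge invariant"*), over the abstract
carrier: for the pair (U, V) (V = U^u) and a relabel `r` (λ ↦ R(u)λ), each of the six readings of `K` — the four sup
entries `e n` of (3.42), the Hölder quantities `h1` (3.43), `e4` (3.44), `h2` (3.45), the six L² quantities `l2 n` (3.46),
the four global quantities `glob n` (3.47) — at U EQUALS the same reading at V on the relabelled argument∕cut-off.  For
K = G′, G this is (3.33)∕(3.34) (X(U^u) = R(u)X(U)R(u^{−1}) for X = G′, G, ∇_U, ∇*_U, Δ_U) with |R(u(x))Y| = |Y|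
(lattice mechanism: `B9Eq333Cov.kernel_bound_iff`, `norm_gaugeAct`).  A HYPOTHESIS SCHEMA; nothing asserted.
[cite: Balaban1985BackgroundPropagators, (3.31)–(3.34) pp.395–396 + p.398] -/
structure KernelReadingsInvariant (K : B9.KernelFamily g B) (U V : B.Cfg) (r : ArgRelabel g) : Prop where
  e : ∀ (n : Fin 4) (lam : g.Loc) (y : g.Site), K.e n U lam y = K.e n V (r.τ lam) y
  h1 : ∀ (lam : g.Loc) (β : ℝ) (ζ : g.Cut), K.h1 U lam β ζ = K.h1 V (r.τ lam) β (r.σ ζ)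
  e4 : ∀ (lam : g.Loc) (y : g.Site), K.e4 U lam y = K.e4 V (r.τ lam) y
  h2 : ∀ (lam : g.Loc) (β : ℝ) (ζ : g.Cut), K.h2 U lam β ζ = K.h2 V (r.τ lam) β (r.σ ζ)
  l2 : ∀ (n : Fin 6) (lam : g.Loc) (h : g.Cut), K.l2 n U lam h = K.l2 n V (r.τ lam) (r.σ h)
  glob : ∀ (n : Fin 4) (lam : g.Loc) (γ : ℝ), K.glob n U lam γ = K.glob n V (r.τ lam) γ

/-- The schema is inhabited at u ≡ 1: every family's readings at U are its readings at U along the identity relabel.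
[cite: Balaban1985BackgroundPropagators, p.398 (bookkeeping: the invariance schema at the identity gauge transformation)] -/
theorem KernelReadingsInvariant.refl (K : B9.KernelFamily g B) (U : B.Cfg) :
    KernelReadingsInvariant K U U (ArgRelabel.refl g) :=
  ⟨fun _ _ _ => rfl, fun _ _ _ => rfl, fun _ _ => rfl, fun _ _ _ => rfl, fun _ _ _ => rfl, fun _ _ _ => rfl⟩

/-- **(3.42), (3.46), (3.47) TRANSFER ALONG A RELABEL**: if the readings of K at U are its readings at V on relabelled
arguments, the β-, ε-free block of Theorem 3.1 at V with constants (B₀, δ₀) gives the same block at U with the SAME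
constants — p. 398 *"All these inequalities are invariant with respect to gauge transformations of U"*, kernel-checked
as pure rewriting (supports preserved, norms equal; no sign facts). [cite: Balaban1985BackgroundPropagators, (3.42) + (3.46) + (3.47) pp.397–398 + p.398] -/
theorem ineq342_346_347_of_invariant {K : B9.KernelFamily g B} {U V : B.Cfg} {r : ArgRelabel g}
    (hK : KernelReadingsInvariant K U V r) {B₀ δ₀ : ℝ} (h : B9.Ineq342_346_347 K B₀ δ₀ V) :
    B9.Ineq342_346_347 K B₀ δ₀ U := by
  refine ⟨fun n lam y y' hs => ?_, fun n lam hc y y' hcut hs => ?_, fun n lam γ h4 h4' => ?_⟩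
  · have h1 := h.1 n (r.τ lam) y y' (r.suppIn lam y' hs)
    rw [← hK.e n lam y, r.supNorm lam] at h1
    exact h1
  · have h2 := h.2.1 n (r.τ lam) (r.σ hc) y y' (r.cutIn hc y hcut) (r.suppIn lam y' hs)
    rw [← hK.l2 n lam hc, r.cutSup hc, r.l2Norm lam] at h2
    exact h2
  · have h3 := h.2.2 n (r.τ lam) γ h4 h4'
    rw [← hK.glob n lam γ, r.wNorm γ lam] at h3
    exact h3

/-- **(3.43)–(3.45) TRANSFER ALONG A RELABEL** (the Hölder block of Theorem 3.1, constants B₀(β), B′₀(ε), B′₀(ε, β), δ₀):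
readings at U = readings at V on relabelled arguments and cut-offs, supports Δ̃(y′) ∕ C₀^∞(Δ̃(y)) preserved, the norms
|λ|, ‖λ‖_ε, ‖ζ‖^ξ_β + |ζ| equal ⇒ the block at V gives the block at U. [cite: Balaban1985BackgroundPropagators, (3.43)–(3.45) p.398 + p.398] -/
theorem ineq343_345_of_invariant {K : B9.KernelFamily g B} {U V : B.Cfg} {r : ArgRelabel g}
    (hK : KernelReadingsInvariant K U V r) {Bβ Bε : ℝ → ℝ} {Bεβ : ℝ → ℝ → ℝ} {δ₀ : ℝ}
    (h : B9.Ineq343_345 K Bβ Bε Bεβ δ₀ V) : B9.Ineq343_345 K Bβ Bε Bεβ δ₀ U := by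
  refine ⟨fun β lam ζ y y' hβ hβ1 hζ hs => ?_, fun ε lam y y' hε hε1 hs => ?_,
    fun ε β lam ζ y y' hε hε1 hβ hβ1 hζ hs => ?_⟩
  · have h1 := h.1 β (r.τ lam) (r.σ ζ) y y' hβ hβ1 (r.cutInT ζ y hζ) (r.suppIn lam y' hs)
    rw [← hK.h1 lam β ζ, r.cutH β ζ, r.supNorm lam] at h1
    exact h1
  · have h2 := h.2.1 ε (r.τ lam) y y' hε hε1 (r.suppInT lam y' hs)
    rw [← hK.e4 lam y, r.holder ε lam, r.supNorm lam] at h2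
    exact h2
  · have h3 := h.2.2 ε β (r.τ lam) (r.σ ζ) y y' hε hε1 hβ hβ1 (r.cutInT ζ y hζ) (r.suppInT lam y' hs)
    rw [← hK.h2 lam β ζ, r.cutH β ζ, r.holder (β + ε) lam, r.supNorm lam] at h3
    exact h3

/-- **(3.48) TRANSFERS**: if the kernel of (Q′(U)G′²(U)Q′*(U))^{−1} at U has the same absolute values as at V
((Q′G′²Q′*)^{−1}(U^u) = R(u)(Q′G′²Q′*)^{−1}(U)R(u^{−1}), `B9Eq333Cov.c_intertwine`, and |R(u(y))YR(u(y′))^{−1}| = |Y|), any bound of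
the (3.48) shape at V holds at U. [cite: Balaban1985BackgroundPropagators, (3.48) p.398 + (3.33) p.396] -/
theorem kerBound_of_invariant {C : B9.SiteKernel g B} {U V : B.Cfg}
    (hC : ∀ y y' : g.Site, |C.ker U y y'| = |C.ker V y y'|) {b : g.Site → g.Site → ℝ}
    (h : ∀ y y' : g.Site, |C.ker V y y'| ≤ b y y') : ∀ y y' : g.Site, |C.ker U y y'| ≤ b y y' :=
  fun y y' => (hC y y').le.trans (h y y')

/-- **«ALL THE RESULTS OF THESE THEOREMS ARE GAUGE INVARIANT» (p. 408), kernel-checked over the abstract carrier**: the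
whole block `B9.Thms31to33IneqAt` of Theorems 3.1–3.3 ((3.42)–(3.47) for G′ and for G, (3.48) for (Q′G′²Q′*)^{−1}) with ANY
constants transfers from V to U along a relabel under which the readings of G′, G are invariant and the kernel of
(Q′G′²Q′*)^{−1} has invariant absolute values. [cite: Balaban1985BackgroundPropagators, Thms 3.1–3.3 pp.397–399 + p.398 + p.408] -/
theorem thms31to33IneqAt_of_invariant {d : ℕ} {Gp GA : B9.KernelFamily g B} {Cinv : B9.SiteKernel g B} {U V : B.Cfg}
    {r : ArgRelabel g} (hGp : KernelReadingsInvariant Gp U V r) (hGA : KernelReadingsInvariant GA U V r)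
    (hC : ∀ y y' : g.Site, |Cinv.ker U y y'| = |Cinv.ker V y y'|)
    {B₀ δ₀ : ℝ} {Bβ Bε : ℝ → ℝ} {Bεβ : ℝ → ℝ → ℝ} {B₁ δ₁ : ℝ}
    (h : B9.Thms31to33IneqAt d Gp GA Cinv B₀ δ₀ Bβ Bε Bεβ B₁ δ₁ V) :
    B9.Thms31to33IneqAt d Gp GA Cinv B₀ δ₀ Bβ Bε Bεβ B₁ δ₁ U :=
  ⟨⟨ineq342_346_347_of_invariant hGp h.1.1, ineq343_345_of_invariant hGp h.1.2⟩,
    kerBound_of_invariant hC h.2.1,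
    ⟨ineq342_346_347_of_invariant hGA h.2.2.1, ineq343_345_of_invariant hGA h.2.2.2⟩⟩

end OneMember

/-! ## §2 The two printed inputs of the gauge reduction, as family schemas -/

section Family

variable {I : Type}

/-- **THE GAUGE FIXING OF (3.35) ON □** (p. 408 ll. 1–6, verbatim in the module docstring): for a member whose domains satisfy
«Ω′₀ ⊂ □ for a cube □ of the class described in (3.35)» (`InCube i`) and a configuration U satisfying (3.35) with α₀, *"applying
the gauge transformation u we get U′ = U^u = e^{iηA} with A satisfying the inequalities in (3.35) … This implies that U′ satisfies
(3.37) for the sequence {Ω′_j}, with U = 1 and α₁ = O(1)Mα₀"* — typed: ∃ U′ in the complex class (3.37) around `one` with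
α₁ = c35·M·α₀ (`c35` = the O(1) of (3.35)) such that U is GAUGE-RELATED to the configuration U′·1 (`Rel i U (mul U′ one)`; `Rel`
abstract = «equal up to a gauge transformation on □»).  The existence of u (an axial-type gauge on the cube, cf. [B7] Props. 4–6)
is NOT in the tree — a HYPOTHESIS SCHEMA of printed shape (GAPS G-B9-14). [cite: Balaban1985BackgroundPropagators, Cor. 3.6 proof p.408 + (3.35)–(3.37) p.396] -/
def GaugeFix335 (c35 : ℝ) (geo : I → B9.Geometry) (bg : I → B9.Backgrounds) (InCube : I → Prop)
    (Rel : ∀ i, (bg i).Cfg → (bg i).Cfg → Prop) : Prop :=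
  ∀ i : I, InCube i → ∀ (α₀ : ℝ) (U : (bg i).Cfg), 0 < α₀ → (bg i).Reg335 c35 α₀ U →
    ∃ U' : (bg i).Cfg, (bg i).Cplx337 (c35 * (geo i).M * α₀) (bg i).one U' ∧ Rel i U ((bg i).mul U' (bg i).one)

/-- **THE READINGS OF G′, G, (Q′G′²Q′*)^{−1} ARE GAUGE INVARIANT, family form** (p. 398 ∕ p. 408; (3.33)–(3.34)): every
gauge-related pair (U, V) of a member carries a relabel of arguments along which the readings of `Gp i` and `GA i` are
invariant and the kernel of `Cinv i` has invariant absolute values.  HYPOTHESIS SCHEMA; inhabited at `Rel := Eq`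
(`readingsGaugeInvariant_eq`). [cite: Balaban1985BackgroundPropagators, (3.33)–(3.34) p.396 + p.398 + p.408] -/
def ReadingsGaugeInvariant (geo : I → B9.Geometry) (bg : I → B9.Backgrounds)
    (Gp GA : ∀ i, B9.KernelFamily (geo i) (bg i)) (Cinv : ∀ i, B9.SiteKernel (geo i) (bg i))
    (Rel : ∀ i, (bg i).Cfg → (bg i).Cfg → Prop) : Prop :=
  ∀ (i : I) (U V : (bg i).Cfg), Rel i U V → ∃ r : ArgRelabel (geo i),
    KernelReadingsInvariant (Gp i) U V r ∧ KernelReadingsInvariant (GA i) U V r ∧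
      ∀ y y' : (geo i).Site, |(Cinv i).ker U y y'| = |(Cinv i).ker V y y'|

/-- Honesty of the schema: with the trivial relation `Rel := (· = ·)` (u ≡ 1) every family's readings are gauge invariant
(identity relabel) — the schema is inhabited, so `gaugeReduction335_of_gaugeFix` is not a vacuous implication in `Rel`.
[cite: Balaban1985BackgroundPropagators, p.398 + (3.33)–(3.34) p.396 (bookkeeping: the family schema at the identity gauge transformation)] -/
theorem readingsGaugeInvariant_eq (geo : I → B9.Geometry) (bg : I → B9.Backgrounds)
    (Gp GA : ∀ i, B9.KernelFamily (geo i) (bg i)) (Cinv : ∀ i, B9.SiteKernel (geo i) (bg i)) :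
    ReadingsGaugeInvariant geo bg Gp GA Cinv (fun i (U V : (bg i).Cfg) => U = V) := by
  rintro i U V rfl
  exact ⟨ArgRelabel.refl (geo i), KernelReadingsInvariant.refl (Gp i) U, KernelReadingsInvariant.refl (GA i) U,
    fun _ _ => rfl⟩

/-! ## §3 The whole printed leaf -/

/-- ★ **COROLLARY 3.6's GAUGE REDUCTION AS THE WHOLE PRINTED LEAF `B9.GaugeReduction335`** (p. 408: *"Applying the gauge
transformation u we get U′ = U^u = e^{iηA} … U′ satisfies (3.37) … with U = 1 and α₁ = O(1)Mα₀ … we have to recall only that all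
the results of these theorems are gauge invariant"*), INHABITED from the two printed inputs: the gauge fixing of (3.35) on □
(`GaugeFix335`, any gauge relation `Rel`) and the gauge invariance of the readings of G′, G, (Q′G′²Q′*)^{−1} along `Rel`
(`ReadingsGaugeInvariant`); the transfer of the block `B9.Thms31to33IneqAt` from U′·1 to U is `thms31to33IneqAt_of_invariant`
with the SAME constants.  Nothing of print asserted (both inputs are hypotheses); NOT a node discharge.
[cite: Balaban1985BackgroundPropagators, Cor. 3.6 proof p.408 + (3.28)–(3.35) pp.395–396 + p.398] -/
theorem gaugeReduction335_of_gaugeFix {d : ℕ} {c35 : ℝ} {geo : I → B9.Geometry} {bg : I → B9.Backgrounds}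
    {InCube : I → Prop} {Gp GA : ∀ i, B9.KernelFamily (geo i) (bg i)} {Cinv : ∀ i, B9.SiteKernel (geo i) (bg i)}
    {Rel : ∀ i, (bg i).Cfg → (bg i).Cfg → Prop} (hfix : GaugeFix335 c35 geo bg InCube Rel)
    (hinv : ReadingsGaugeInvariant geo bg Gp GA Cinv Rel) :
    B9.GaugeReduction335 d c35 geo bg InCube Gp GA Cinv := by
  intro i hi α₀ U hα hU
  obtain ⟨U', h337, hrel⟩ := hfix i hi α₀ U hα hU
  obtain ⟨r, hGp, hGA, hC⟩ := hinv i U _ hrel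
  exact ⟨U', h337, fun B₀ δ₀ Bβ Bε Bεβ B₁ δ₁ h => thms31to33IneqAt_of_invariant hGp hGA hC h⟩

/-! ## §4 The located vacuity of the leaf when no member satisfies «Ω′₀ ⊂ □» -/

/-- ★ **THE LEAF IS VACUOUS WHEN NO MEMBER SATISFIES «Ω′₀ ⊂ □»** (located bookkeeping): `B9.GaugeReduction335` quantifies
`∀ i, InCube i → …`, so over a family with `¬ InCube i` for every member it holds for ALL operator families and constants.
This is the case AT pub-ymgap's PIN OF RECORD: def-Y's `B9PinGeometryKLevelV1.not_inCubeY` refutes `InCubeY x` at every member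
of the torus families (`Ω₀ = T_η` does not fit in a (3.35)-class cube; the frame limitation behind
`B9PinGeometryKLevelV1.cor36Printed_vacuous`), so the N06 knit's binder `hg` is THIS lemma at `h := not_inCubeY` — content-free
there, recorded so that no one reads a discharge of G-B9-14 into it; the substantive reduction is §3 on carriers where `InCube`
is inhabited (the Dirichlet member sort of [4] p. 228 ∕ 248, not typed in the tree).
[cite: Balaban1985BackgroundPropagators, Cor. 3.6 proof p.408 (bookkeeping: vacuity of the typed leaf when «Ω′₀ ⊂ □» has no member)] -/
theorem gaugeReduction335_of_not_inCube {d : ℕ} {c35 : ℝ} {geo : I → B9.Geometry} {bg : I → B9.Backgrounds}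
    {InCube : I → Prop} (Gp GA : ∀ i, B9.KernelFamily (geo i) (bg i)) (Cinv : ∀ i, B9.SiteKernel (geo i) (bg i))
    (h : ∀ i : I, ¬ InCube i) : B9.GaugeReduction335 d c35 geo bg InCube Gp GA Cinv :=
  fun i hi => absurd hi (h i)

end Family

end Literature.MathematicalPhysics.QuantumFieldTheory.Balaban1983to89.B9GaugeReduction335Whole
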